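import Summits.CriticalPhenomena.PercolationContinuityZ3.Theorems.SahiAEBandSupport
import Summits.CriticalPhenomena.PercolationContinuityZ3.Theorems.SahiAEVersionTransport

/-!
# Sections of planar sets and fullness after the quantile transport (preliminaries for `SahiAEPlaneZeros.lean`)

Support file of the Sahi cell (`prim-sahi`, typer seat, generation 24; `--supports stmt-CriticalPhenomena-4575`).
Theorems only (no definitions, no named facts, no sorries).

* Vertical / horizontal sections of measurable planar sets through `ℝ² ≃ ℝ × ℝ`: Fubini (`volume_eq_lintegral_sections'`,
  companion of `volume_eq_lintegral_sections` of `SahiAEBandSupport.lean`), measurability of the section measures and of the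
  sections; a planar set lies almost everywhere over the abscissae (ordinates) of its non-null vertical (horizontal)
  sections (`ae_apply_zero_mem`, `ae_apply_one_mem`).
* **Fullness after transport** (`ae_vertical_line_meets`, `ae_horizontal_line_meets`): with `X₀ ⊇` the abscissae of
  the non-null vertical sections of `S`, `S` a.e. over `ℝ × X₁`, probability measures `ν₀ ~ λ|_{X₀}`-dominated and
  `λ|_{X₁} ≪ ν₁`, and `L` a measurable set agreeing a.e. on the open unit square with the preimage of `S` under the
  coordinatewise quantile map `(rqe ν₀, rqe ν₁)` of `SahiAEVersionTransportPrelim.lean`: almost every vertical line of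
  the square MEETS `L` (pull back along the measure-preserving quantile maps; a non-null section is non-empty).

No sorries, no new axioms.
-/

noncomputable section

namespace Summit.CriticalPhenomena.PercolationContinuityZ3.Theorems.SahiAEFourFunctions

namespace Plane

open MeasureTheory Set Filter Topology Function ProbabilityTheory
open Summit.CriticalPhenomena.PercolationContinuityZ3.Theorems.SahiBoxTP2 (IsBoxTP2)
open scoped ENNReal NNReal

/-! ### Sections -/

/-- Horizontal sections of a planar set. [folklore] -/
theorem volume_eq_lintegral_sections' {E : Set (Fin 2 → ℝ)} (hE : MeasurableSet E) :
    volume E = ∫⁻ t, volume {s : ℝ | (![s, t] : Fin 2 → ℝ) ∈ E} := by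
  have hmp := MeasureTheory.volume_preserving_finTwoArrow ℝ
  have hE' : MeasurableSet ((MeasurableEquiv.finTwoArrow (α := ℝ)).symm ⁻¹' E) :=
    (MeasurableEquiv.finTwoArrow (α := ℝ)).symm.measurable hE
  have h1 : volume E = volume ((MeasurableEquiv.finTwoArrow (α := ℝ)).symm ⁻¹' E) := by
    rw [← hmp.measure_preimage hE'.nullMeasurableSet, ← Set.preimage_comp, MeasurableEquiv.symm_comp_self,
      Set.preimage_id]
  rw [h1, show (volume : Measure (ℝ × ℝ)) = (volume : Measure ℝ).prod volume from rfl, Measure.prod_apply_symm hE']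
  rfl

/-- The vertical section measure is measurable in the abscissa. [folklore] -/
theorem measurable_volume_section {E : Set (Fin 2 → ℝ)} (hE : MeasurableSet E) :
    Measurable fun s : ℝ => volume {t : ℝ | (![s, t] : Fin 2 → ℝ) ∈ E} := by
  have hE' : MeasurableSet ((MeasurableEquiv.finTwoArrow (α := ℝ)).symm ⁻¹' E) :=
    (MeasurableEquiv.finTwoArrow (α := ℝ)).symm.measurable hE
  exact measurable_measure_prodMk_left (ν := (volume : Measure ℝ)) hE'

/-- The horizontal section measure is measurable in the ordinate. [folklore] -/
theorem measurable_volume_section' {E : Set (Fin 2 → ℝ)} (hE : MeasurableSet E) :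
    Measurable fun t : ℝ => volume {s : ℝ | (![s, t] : Fin 2 → ℝ) ∈ E} := by
  have hE' : MeasurableSet ((MeasurableEquiv.finTwoArrow (α := ℝ)).symm ⁻¹' E) :=
    (MeasurableEquiv.finTwoArrow (α := ℝ)).symm.measurable hE
  exact measurable_measure_prodMk_right (μ := (volume : Measure ℝ)) hE'

/-- The vertical section of a measurable planar set is measurable. [folklore] -/
theorem measurableSet_section {E : Set (Fin 2 → ℝ)} (hE : MeasurableSet E) (s : ℝ) :
    MeasurableSet {t : ℝ | (![s, t] : Fin 2 → ℝ) ∈ E} :=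
  hE.preimage (measurable_pi_iff.2 fun i => by
    fin_cases i
    · exact measurable_const
    · exact measurable_id)

/-- The horizontal section of a measurable planar set is measurable. [folklore] -/
theorem measurableSet_section' {E : Set (Fin 2 → ℝ)} (hE : MeasurableSet E) (t : ℝ) :
    MeasurableSet {s : ℝ | (![s, t] : Fin 2 → ℝ) ∈ E} :=
  hE.preimage (measurable_pi_iff.2 fun i => by
    fin_cases i
    · exact measurable_id
    · exact measurable_const)

/-- **A planar set lies almost everywhere over the abscissae of its non-null vertical sections.** [folklore] -/
theorem ae_apply_zero_mem {E : Set (Fin 2 → ℝ)} (hE : MeasurableSet E) :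
    ∀ᵐ x ∂(volume : Measure (Fin 2 → ℝ)), x ∈ E →
      x 0 ∈ {s : ℝ | volume {t : ℝ | (![s, t] : Fin 2 → ℝ) ∈ E} ≠ 0} := by
  set X : Set ℝ := {s : ℝ | volume {t : ℝ | (![s, t] : Fin 2 → ℝ) ∈ E} ≠ 0} with hX
  have mX : MeasurableSet X := (measurable_volume_section hE (measurableSet_singleton 0)).compl
  have mD : MeasurableSet (E \ {x | x 0 ∈ X}) := hE.diff (measurable_pi_apply 0 mX)
  have h0 : volume (E \ {x : Fin 2 → ℝ | x 0 ∈ X}) = 0 := by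
    rw [volume_eq_lintegral_sections mD]
    have : ∀ s, volume {t : ℝ | (![s, t] : Fin 2 → ℝ) ∈ E \ {x | x 0 ∈ X}} = 0 := by
      intro s
      by_cases hs : s ∈ X
      · have : {t : ℝ | (![s, t] : Fin 2 → ℝ) ∈ E \ {x | x 0 ∈ X}} = ∅ := by
          ext t; simp [hs]
        rw [this, measure_empty]
      · have e : {t : ℝ | (![s, t] : Fin 2 → ℝ) ∈ E \ {x | x 0 ∈ X}} = {t : ℝ | (![s, t] : Fin 2 → ℝ) ∈ E} := by
          ext t; simp [hs]
        rw [e]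
        simpa [hX] using hs
    simp only [this, lintegral_zero]
  filter_upwards [measure_eq_zero_iff_ae_notMem.1 h0] with x hx hxE
  by_contra hcon
  exact hx ⟨hxE, hcon⟩

/-- **A planar set lies almost everywhere over the ordinates of its non-null horizontal sections.** [folklore] -/
theorem ae_apply_one_mem {E : Set (Fin 2 → ℝ)} (hE : MeasurableSet E) :
    ∀ᵐ x ∂(volume : Measure (Fin 2 → ℝ)), x ∈ E →
      x 1 ∈ {t : ℝ | volume {s : ℝ | (![s, t] : Fin 2 → ℝ) ∈ E} ≠ 0} := by
  set X : Set ℝ := {t : ℝ | volume {s : ℝ | (![s, t] : Fin 2 → ℝ) ∈ E} ≠ 0} with hX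
  have mX : MeasurableSet X := (measurable_volume_section' hE (measurableSet_singleton 0)).compl
  have mD : MeasurableSet (E \ {x | x 1 ∈ X}) := hE.diff (measurable_pi_apply 1 mX)
  have h0 : volume (E \ {x : Fin 2 → ℝ | x 1 ∈ X}) = 0 := by
    rw [volume_eq_lintegral_sections' mD]
    have : ∀ t, volume {s : ℝ | (![s, t] : Fin 2 → ℝ) ∈ E \ {x | x 1 ∈ X}} = 0 := by
      intro t
      by_cases ht : t ∈ X
      · have : {s : ℝ | (![s, t] : Fin 2 → ℝ) ∈ E \ {x | x 1 ∈ X}} = ∅ := by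
          ext s; simp [ht]
        rw [this, measure_empty]
      · have e : {s : ℝ | (![s, t] : Fin 2 → ℝ) ∈ E \ {x | x 1 ∈ X}} = {s : ℝ | (![s, t] : Fin 2 → ℝ) ∈ E} := by
          ext s; simp [ht]
        rw [e]
        simpa [hX] using ht
    simp only [this, lintegral_zero]
  filter_upwards [measure_eq_zero_iff_ae_notMem.1 h0] with x hx hxE
  by_contra hcon
  exact hx ⟨hxE, hcon⟩

/-- Product sets are sublattices. [folklore] -/
theorem inf_sup_mem_prodSet {X₀ X₁ : Set ℝ} {x y : Fin 2 → ℝ} (hx : x 0 ∈ X₀ ∧ x 1 ∈ X₁) (hy : y 0 ∈ X₀ ∧ y 1 ∈ X₁) :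
    ((x ⊓ y) 0 ∈ X₀ ∧ (x ⊓ y) 1 ∈ X₁) ∧ ((x ⊔ y) 0 ∈ X₀ ∧ (x ⊔ y) 1 ∈ X₁) := by
  simp only [Pi.inf_apply, Pi.sup_apply]
  refine ⟨⟨?_, ?_⟩, ?_, ?_⟩
  · rcases le_total (x 0) (y 0) with h | h
    · rw [min_eq_left h]; exact hx.1
    · rw [min_eq_right h]; exact hy.1
  · rcases le_total (x 1) (y 1) with h | h
    · rw [min_eq_left h]; exact hx.2
    · rw [min_eq_right h]; exact hy.2
  · rcases le_total (x 0) (y 0) with h | h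
    · rw [max_eq_right h]; exact hy.1
    · rw [max_eq_left h]; exact hx.1
  · rcases le_total (x 1) (y 1) with h | h
    · rw [max_eq_right h]; exact hy.2
    · rw [max_eq_left h]; exact hx.2

/-- The symmetric difference event of two measurable sets is measurable. [folklore] -/
theorem measurableSet_not_iff {L S : Set (Fin 2 → ℝ)} (mL : MeasurableSet L) (mS : MeasurableSet S) :
    MeasurableSet {u : Fin 2 → ℝ | ¬(u ∈ L ↔ u ∈ S)} := by
  have : {u : Fin 2 → ℝ | ¬(u ∈ L ↔ u ∈ S)} = (L \ S) ∪ (S \ L) := by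
    ext u
    simp only [Set.mem_setOf_eq, Set.mem_union, Set.mem_sdiff]
    by_cases h1 : u ∈ L <;> by_cases h2 : u ∈ S <;> simp [h1, h2]
  rw [this]; exact (mL.diff mS).union (mS.diff mL)

/-- **Fullness after transport, vertical lines.**  Let `S ⊆ ℝ²` be measurable, `X₀ ⊇` no abscissa of a null vertical
section of `S`, `S` a.e. over `ℝ × X₁`, `ν₀ ≪ λ|_{X₀}` and `λ|_{X₁} ≪ ν₁` probability measures, and `L` a measurable
set which on the open unit square coincides a.e. with the preimage of `S` under the coordinatewise quantile map of
`(ν₀, ν₁)`.  Then almost every vertical line of the square meets `L`. [this work] -/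
theorem ae_vertical_line_meets {S : Set (Fin 2 → ℝ)} (mS : MeasurableSet S) {X : Fin 2 → Set ℝ}
    (mX : ∀ i, MeasurableSet (X i)) (hX0 : ∀ a ∈ X 0, volume {r : ℝ | (![a, r] : Fin 2 → ℝ) ∈ S} ≠ 0)
    (hX1 : ∀ᵐ a ∂(volume : Measure ℝ), volume ({r : ℝ | (![a, r] : Fin 2 → ℝ) ∈ S} \ X 1) = 0)
    (ν : Fin 2 → Measure ℝ) [∀ i, IsProbabilityMeasure (ν i)]
    (hν : ∀ i, ν i ≪ (volume : Measure ℝ).restrict (X i)) (hν' : ∀ i, (volume : Measure ℝ).restrict (X i) ≪ ν i)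
    {L : Set (Fin 2 → ℝ)} (mL : MeasurableSet L)
    (hLS : ∀ᵐ u ∂(volume : Measure (Fin 2 → ℝ)), u ∈ Set.pi univ (fun _ => Ioo (0 : ℝ) 1) →
      (u ∈ L ↔ (fun i => rqe (ν i) (u i)) ∈ S)) :
    ∀ᵐ s ∂(volume : Measure ℝ), s ∈ Ioo (0 : ℝ) 1 → ∃ z ∈ L, z 0 = s := by
  set U : Set (Fin 2 → ℝ) := Set.pi univ fun _ => Ioo (0 : ℝ) 1 with hU
  have mU : MeasurableSet U := MeasurableSet.univ_pi fun _ => measurableSet_Ioo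
  set S' : Set (Fin 2 → ℝ) := {u | (fun i => rqe (ν i) (u i)) ∈ S} with hS'
  have mS' : MeasurableSet S' :=
    mS.preimage (measurable_pi_iff.2 fun i => (measurable_rqe (ν i)).comp (measurable_pi_apply i))
  have hsecS : ∀ a : ℝ, MeasurableSet {r : ℝ | (![a, r] : Fin 2 → ℝ) ∈ S} := measurableSet_section mS
  -- (a) for `ν 0`-a.e. `a`, the section of `S` at `a` has positive `ν 1`-measure
  have hνpos : ∀ᵐ a ∂(ν 0), (ν 1) {r : ℝ | (![a, r] : Fin 2 → ℝ) ∈ S} ≠ 0 := by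
    have h1 : ∀ᵐ a ∂(volume : Measure ℝ).restrict (X 0),
        a ∈ X 0 ∧ volume ({r : ℝ | (![a, r] : Fin 2 → ℝ) ∈ S} \ X 1) = 0 :=
      (ae_restrict_mem (mX 0)).and (ae_restrict_of_ae hX1)
    filter_upwards [(hν 0).ae_le h1] with a ha
    have hρ1 : (volume : Measure ℝ).restrict (X 1) {r : ℝ | (![a, r] : Fin 2 → ℝ) ∈ S} ≠ 0 := by
      rw [Measure.restrict_apply (hsecS a)]
      intro h0
      have h3 : volume {r : ℝ | (![a, r] : Fin 2 → ℝ) ∈ S} = 0 := by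
        rw [← Set.inter_union_sdiff {r : ℝ | (![a, r] : Fin 2 → ℝ) ∈ S} (X 1)]
        exact measure_union_null h0 ha.2
      exact hX0 a ha.1 h3
    exact fun h => hρ1 (hν' 1 h)
  -- (b) pull back along the quantile map of `ν 0`
  have h3 : ∀ᵐ s ∂(volume : Measure ℝ).restrict (Ioo (0 : ℝ) 1),
      (ν 1) {r : ℝ | (![rqe (ν 0) s, r] : Fin 2 → ℝ) ∈ S} ≠ 0 :=
    (measurePreserving_rqe (ν 0)).quasiMeasurePreserving.ae hνpos
  -- (c) the sections of `L` and `S'` agree for a.e. `s`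
  have h4 : ∀ᵐ s ∂(volume : Measure ℝ), volume {t : ℝ | (![s, t] : Fin 2 → ℝ) ∈ (U ∩ {u | ¬(u ∈ L ↔ u ∈ S')})} = 0 := by
    have mD : MeasurableSet (U ∩ {u | ¬(u ∈ L ↔ u ∈ S')}) := mU.inter (measurableSet_not_iff mL mS')
    have h0 : volume (U ∩ {u | ¬(u ∈ L ↔ u ∈ S')}) = 0 :=
      measure_eq_zero_iff_ae_notMem.2 (by filter_upwards [hLS] with u hu h using h.2 (hu h.1))
    rw [volume_eq_lintegral_sections mD, lintegral_eq_zero_iff (measurable_volume_section mD)] at h0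
    exact h0
  have h5 := (ae_restrict_iff' (measurableSet_Ioo (a := (0 : ℝ)) (b := 1))).1 h3
  filter_upwards [h4, h5] with s hs4 hs5 hsI
  have hTst : ∀ t : ℝ, (fun i => rqe (ν i) ((![s, t] : Fin 2 → ℝ) i)) = ![rqe (ν 0) s, rqe (ν 1) t] := fun t => by
    funext i; fin_cases i <;> simp
  have hset : {t | (![s, t] : Fin 2 → ℝ) ∈ S'} = rqe (ν 1) ⁻¹' {r : ℝ | (![rqe (ν 0) s, r] : Fin 2 → ℝ) ∈ S} := by
    ext t
    simp only [hS', Set.mem_setOf_eq, Set.mem_preimage, hTst]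
  have hpos : volume ({t | (![s, t] : Fin 2 → ℝ) ∈ S'} ∩ Ioo (0 : ℝ) 1) ≠ 0 := by
    rw [← Measure.restrict_apply' measurableSet_Ioo, hset,
      (measurePreserving_rqe (ν 1)).measure_preimage (hsecS _).nullMeasurableSet]
    exact hs5 hsI
  have hsub : {t | (![s, t] : Fin 2 → ℝ) ∈ S'} ∩ Ioo (0 : ℝ) 1 ⊆
      {t : ℝ | (![s, t] : Fin 2 → ℝ) ∈ L} ∪ {t : ℝ | (![s, t] : Fin 2 → ℝ) ∈ (U ∩ {u | ¬(u ∈ L ↔ u ∈ S')})} := by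
    rintro t ⟨ht, htI⟩
    by_cases hL' : (![s, t] : Fin 2 → ℝ) ∈ L
    · exact Or.inl hL'
    · refine Or.inr ⟨Set.mem_univ_pi.2 fun i => ?_, fun h => hL' (h.2 ht)⟩
      fin_cases i
      · simpa using hsI
      · simpa using htI
  have hLpos : volume {t : ℝ | (![s, t] : Fin 2 → ℝ) ∈ L} ≠ 0 := fun h0 =>
    hpos (measure_mono_null hsub (measure_union_null h0 hs4))
  obtain ⟨t, ht⟩ := nonempty_of_measure_ne_zero hLpos
  exact ⟨![s, t], ht, by simp⟩

/-- **Fullness after transport, horizontal lines** (the transposed statement). [this work] -/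
theorem ae_horizontal_line_meets {S : Set (Fin 2 → ℝ)} (mS : MeasurableSet S) {X : Fin 2 → Set ℝ}
    (mX : ∀ i, MeasurableSet (X i)) (hX1 : ∀ b ∈ X 1, volume {r : ℝ | (![r, b] : Fin 2 → ℝ) ∈ S} ≠ 0)
    (hX0 : ∀ᵐ b ∂(volume : Measure ℝ), volume ({r : ℝ | (![r, b] : Fin 2 → ℝ) ∈ S} \ X 0) = 0)
    (ν : Fin 2 → Measure ℝ) [∀ i, IsProbabilityMeasure (ν i)]
    (hν : ∀ i, ν i ≪ (volume : Measure ℝ).restrict (X i)) (hν' : ∀ i, (volume : Measure ℝ).restrict (X i) ≪ ν i)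
    {L : Set (Fin 2 → ℝ)} (mL : MeasurableSet L)
    (hLS : ∀ᵐ u ∂(volume : Measure (Fin 2 → ℝ)), u ∈ Set.pi univ (fun _ => Ioo (0 : ℝ) 1) →
      (u ∈ L ↔ (fun i => rqe (ν i) (u i)) ∈ S)) :
    ∀ᵐ t ∂(volume : Measure ℝ), t ∈ Ioo (0 : ℝ) 1 → ∃ z ∈ L, z 1 = t := by
  set U : Set (Fin 2 → ℝ) := Set.pi univ fun _ => Ioo (0 : ℝ) 1 with hU
  have mU : MeasurableSet U := MeasurableSet.univ_pi fun _ => measurableSet_Ioo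
  set S' : Set (Fin 2 → ℝ) := {u | (fun i => rqe (ν i) (u i)) ∈ S} with hS'
  have mS' : MeasurableSet S' :=
    mS.preimage (measurable_pi_iff.2 fun i => (measurable_rqe (ν i)).comp (measurable_pi_apply i))
  have hsecS' : ∀ b : ℝ, MeasurableSet {r : ℝ | (![r, b] : Fin 2 → ℝ) ∈ S} := measurableSet_section' mS
  have hνpos : ∀ᵐ b ∂(ν 1), (ν 0) {r : ℝ | (![r, b] : Fin 2 → ℝ) ∈ S} ≠ 0 := by
    have h1 : ∀ᵐ b ∂(volume : Measure ℝ).restrict (X 1),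
        b ∈ X 1 ∧ volume ({r : ℝ | (![r, b] : Fin 2 → ℝ) ∈ S} \ X 0) = 0 :=
      (ae_restrict_mem (mX 1)).and (ae_restrict_of_ae hX0)
    filter_upwards [(hν 1).ae_le h1] with b hb
    have hρ0 : (volume : Measure ℝ).restrict (X 0) {r : ℝ | (![r, b] : Fin 2 → ℝ) ∈ S} ≠ 0 := by
      rw [Measure.restrict_apply (hsecS' b)]
      intro h0
      have h3 : volume {r : ℝ | (![r, b] : Fin 2 → ℝ) ∈ S} = 0 := by
        rw [← Set.inter_union_sdiff {r : ℝ | (![r, b] : Fin 2 → ℝ) ∈ S} (X 0)]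
        exact measure_union_null h0 hb.2
      exact hX1 b hb.1 h3
    exact fun h => hρ0 (hν' 0 h)
  have h3 : ∀ᵐ t ∂(volume : Measure ℝ).restrict (Ioo (0 : ℝ) 1),
      (ν 0) {r : ℝ | (![r, rqe (ν 1) t] : Fin 2 → ℝ) ∈ S} ≠ 0 :=
    (measurePreserving_rqe (ν 1)).quasiMeasurePreserving.ae hνpos
  have h4 : ∀ᵐ t ∂(volume : Measure ℝ), volume {s : ℝ | (![s, t] : Fin 2 → ℝ) ∈ (U ∩ {u | ¬(u ∈ L ↔ u ∈ S')})} = 0 := by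
    have mD : MeasurableSet (U ∩ {u | ¬(u ∈ L ↔ u ∈ S')}) := mU.inter (measurableSet_not_iff mL mS')
    have h0 : volume (U ∩ {u | ¬(u ∈ L ↔ u ∈ S')}) = 0 :=
      measure_eq_zero_iff_ae_notMem.2 (by filter_upwards [hLS] with u hu h using h.2 (hu h.1))
    rw [volume_eq_lintegral_sections' mD, lintegral_eq_zero_iff (measurable_volume_section' mD)] at h0
    exact h0
  have h5 := (ae_restrict_iff' (measurableSet_Ioo (a := (0 : ℝ)) (b := 1))).1 h3
  filter_upwards [h4, h5] with t ht4 ht5 htI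
  have hTst : ∀ s : ℝ, (fun i => rqe (ν i) ((![s, t] : Fin 2 → ℝ) i)) = ![rqe (ν 0) s, rqe (ν 1) t] := fun s => by
    funext i; fin_cases i <;> simp
  have hset : {s | (![s, t] : Fin 2 → ℝ) ∈ S'} = rqe (ν 0) ⁻¹' {r : ℝ | (![r, rqe (ν 1) t] : Fin 2 → ℝ) ∈ S} := by
    ext s
    simp only [hS', Set.mem_setOf_eq, Set.mem_preimage, hTst]
  have hpos : volume ({s | (![s, t] : Fin 2 → ℝ) ∈ S'} ∩ Ioo (0 : ℝ) 1) ≠ 0 := by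
    rw [← Measure.restrict_apply' measurableSet_Ioo, hset,
      (measurePreserving_rqe (ν 0)).measure_preimage (hsecS' _).nullMeasurableSet]
    exact ht5 htI
  have hsub : {s | (![s, t] : Fin 2 → ℝ) ∈ S'} ∩ Ioo (0 : ℝ) 1 ⊆
      {s : ℝ | (![s, t] : Fin 2 → ℝ) ∈ L} ∪ {s : ℝ | (![s, t] : Fin 2 → ℝ) ∈ (U ∩ {u | ¬(u ∈ L ↔ u ∈ S')})} := by
    rintro s ⟨hs, hsI⟩
    by_cases hL' : (![s, t] : Fin 2 → ℝ) ∈ L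
    · exact Or.inl hL'
    · refine Or.inr ⟨Set.mem_univ_pi.2 fun i => ?_, fun h => hL' (h.2 hs)⟩
      fin_cases i
      · simpa using hsI
      · simpa using htI
  have hLpos : volume {s : ℝ | (![s, t] : Fin 2 → ℝ) ∈ L} ≠ 0 := fun h0 =>
    hpos (measure_mono_null hsub (measure_union_null h0 ht4))
  obtain ⟨s, hs⟩ := nonempty_of_measure_ne_zero hLpos
  exact ⟨![s, t], hs, by simp⟩

end Plane

end Summit.CriticalPhenomena.PercolationContinuityZ3.Theorems.SahiAEFourFunctions
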